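import Mathlib.LinearAlgebra.Matrix.GeneralLinearGroup.Defs
import Mathlib.LinearAlgebra.Matrix.Determinant.Basic
import Summits.Langlands.Langlands.Theorems.PhantomRMYoshidaPhantomRMTransportEigen

/-!
# Route `PhantomRMYoshida`, support item `PhantomRMTransport` (stmt-Langlands-13641): the rank-two
# constituent `σ`

Helpers for the transport lemma `Summit.Langlands.Langlands.Theses.PhantomRMYoshida.PhantomRMTransport`.
Setting: a homomorphism `R : Γ → M₄(k)` (a monoid hom into the matrix ring), a plane `W ⊆ k⁴` stable
under every `R g` with a basis `e₀, e₁`, and the matrices `S g ∈ M₂(k)` of `R g|_W` in that basis,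
characterised by `R g e_j = ∑ i, S g i j • e i` (`exists_matrix_of_mapsTo` produces them).  Then
`g ↦ S g` is multiplicative (`matrix_mul`, `matrix_one`), so it is a homomorphism `σ : Γ → GL₂(k)`
(`exists_hom_val_eq`), and if `R` preserves a bilinear form `J` up to the multiplier `c g`
(`(R g)ᵀ J (R g) = c g • J`) which is alternating with `e₀ᵀ J e₁ ≠ 0`, then `det S g = c g`
(`det_matrix_eq`).
-/

set_option linter.dupNamespace false
set_option autoImplicit false

namespace Summit.Langlands.Langlands.Theorems.PhantomRMTransport

open Matrix Module

universe u v

variable {k : Type u} [Field k] {n : Type*} [Fintype n]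

/-- A matrix applied to a linear combination. [folklore] -/
theorem mulVec_sum_smul {m : Type*} [Fintype m] (M : Matrix n n k) (c : m → k) (v : m → n → k) :
    M *ᵥ (∑ i, c i • v i) = ∑ i, c i • (M *ᵥ v i) := by
  change Matrix.mulVecLin M (∑ i, c i • v i) = _
  rw [map_sum]
  simp only [map_smul, Matrix.mulVecLin_apply]

/-- **The matrices of `R g` on a stable subspace.** If `W` is stable under every `R g` and spanned by
the family `e`, there are matrices `S g` with `R g e_j = ∑ i, S g i j • e i`. [folklore] -/
theorem exists_matrix_of_mapsTo {Γ : Type v} {m : Type*} [Fintype m] (R : Γ → Matrix n n k) (W : Submodule k (n → k))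
    (e : m → n → k) (he : ∀ j, e j ∈ W) (hspan : W ≤ Submodule.span k (Set.range e))
    (hW : ∀ g, ∀ v ∈ W, R g *ᵥ v ∈ W) :
    ∃ S : Γ → Matrix m m k, ∀ g j, R g *ᵥ e j = ∑ i, S g i j • e i := by
  have h : ∀ g j, ∃ c : m → k, ∑ i, c i • e i = R g *ᵥ e j := fun g j =>
    (Submodule.mem_span_range_iff_exists_fun k).1 (hspan (hW g (e j) (he j)))
  choose c hc using h
  exact ⟨fun g i j => c g j i, fun g j => (hc g j).symm⟩

/-- Skew-symmetry of the form of an alternating matrix: `wᵀ J v = - vᵀ J w`. [folklore] -/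
theorem dotProduct_mulVec_swap {J : Matrix n n k} (hJ : Jᵀ = -J) (v w : n → k) :
    w ⬝ᵥ (J *ᵥ v) = -(v ⬝ᵥ (J *ᵥ w)) := by
  rw [Matrix.dotProduct_mulVec, ← Matrix.mulVec_transpose, hJ, Matrix.neg_mulVec, dotProduct_comm,
    dotProduct_neg]

section Matrices

variable [DecidableEq n] {Γ : Type v} [Monoid Γ] {m : Type*} [Fintype m] [DecidableEq m]
  {e : m → n → k}

omit [Fintype n] [DecidableEq n] [DecidableEq m] in
/-- Coordinates along a linearly independent family are unique. [folklore] -/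
theorem eq_of_sum_smul_eq (hli : LinearIndependent k e) {c d : m → k}
    (h : ∑ i, c i • e i = ∑ i, d i • e i) : c = d := by
  have h0 : ∑ i, (c - d) i • e i = 0 := by
    simp only [Pi.sub_apply, sub_smul, Finset.sum_sub_distrib, h, sub_self]
  funext i
  exact sub_eq_zero.1 (Fintype.linearIndependent_iff.1 hli (c - d) h0 i)

variable {R : Γ →* Matrix n n k} {S : Γ → Matrix m m k}

omit [DecidableEq m] in
/-- The matrices `S g` are multiplicative. [folklore] -/
theorem matrix_mul (hli : LinearIndependent k e) (hS : ∀ g j, R g *ᵥ e j = ∑ i, S g i j • e i)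
    (g h : Γ) : S (g * h) = S g * S h := by
  -- compare the coordinates of `R (g h) e_j` computed in two ways
  have hcol : ∀ j, (fun i => S (g * h) i j) = fun l => (S g * S h) l j := by
    intro j
    apply eq_of_sum_smul_eq hli
    calc ∑ i, S (g * h) i j • e i = R (g * h) *ᵥ e j := (hS (g * h) j).symm
      _ = R g *ᵥ (R h *ᵥ e j) := by rw [map_mul, Matrix.mulVec_mulVec]
      _ = ∑ i, S h i j • (R g *ᵥ e i) := by rw [hS h j, mulVec_sum_smul]
      _ = ∑ i, S h i j • ∑ l, S g l i • e l := by simp_rw [hS g]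
      _ = ∑ l, (S g * S h) l j • e l := by
          simp_rw [Finset.smul_sum, smul_smul, Matrix.mul_apply, Finset.sum_smul]
          rw [Finset.sum_comm]
          refine Finset.sum_congr rfl fun l _ => Finset.sum_congr rfl fun i _ => ?_
          rw [mul_comm]
  ext i j
  exact congrFun (hcol j) i

omit [DecidableEq m] in
/-- `R g` on a vector with coordinates `c` has coordinates `S g *ᵥ c`. [folklore] -/
theorem mulVec_sum_smul_eq (hS : ∀ g j, R g *ᵥ e j = ∑ i, S g i j • e i) (g : Γ) (c : m → k) :
    R g *ᵥ (∑ j, c j • e j) = ∑ i, (S g *ᵥ c) i • e i := by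
  rw [mulVec_sum_smul]
  simp_rw [hS g, Finset.smul_sum, smul_smul, Matrix.mulVec, dotProduct, Finset.sum_smul]
  rw [Finset.sum_comm]
  exact Finset.sum_congr rfl fun l _ => Finset.sum_congr rfl fun i _ => by rw [mul_comm]

/-- The matrix of `R 1 = 1` is `1`. [folklore] -/
theorem matrix_one (hli : LinearIndependent k e) (hS : ∀ g j, R g *ᵥ e j = ∑ i, S g i j • e i) :
    S 1 = 1 := by
  have hcol : ∀ j, (fun i => S 1 i j) = fun i => (1 : Matrix m m k) i j := by
    intro j
    apply eq_of_sum_smul_eq hli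
    rw [← hS 1 j, map_one, Matrix.one_mulVec]
    simp only [Matrix.one_apply, ite_smul, one_smul, zero_smul, Finset.sum_ite_eq', Finset.mem_univ,
      if_true]
  ext i j
  exact congrFun (hcol j) i

/-- **The homomorphism `σ`.** The matrices `S g` come from a homomorphism `σ : Γ → GL_m(k)`
(for a group `Γ`). [folklore] -/
theorem exists_hom_val_eq {Γ : Type v} [Group Γ] {R : Γ →* Matrix n n k} {S : Γ → Matrix m m k}
    (hli : LinearIndependent k e) (hS : ∀ g j, R g *ᵥ e j = ∑ i, S g i j • e i) :
    ∃ σ : Γ →* GL m k, ∀ g, ((σ g : GL m k) : Matrix m m k) = S g := by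
  let Smon : Γ →* Matrix m m k :=
    { toFun := S
      map_one' := matrix_one hli hS
      map_mul' := matrix_mul hli hS }
  exact ⟨Smon.toHomUnits, fun g => rfl⟩

/-! ### The determinant on an invariant symplectic plane -/

/-- **`det σ = multiplier`.** On an `R`-stable plane with basis `e 0, e 1` on which the alternating
form `J` has `β = (e 0)ᵀ J (e 1) ≠ 0`, a similitude `R g` of multiplier `c` (`(R g)ᵀ J (R g) = c • J`)
acts with determinant `c`: `(R g e₀)ᵀ J (R g e₁) = det(S g) · β = c · β`. [folklore] -/
theorem det_matrix_eq {e : Fin 2 → n → k} {S : Γ → Matrix (Fin 2) (Fin 2) k} {J : Matrix n n k}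
    (hJ : Jᵀ = -J) (h2 : (2 : k) ≠ 0) (hS : ∀ g j, R g *ᵥ e j = ∑ i, S g i j • e i)
    (hβ : e 0 ⬝ᵥ (J *ᵥ e 1) ≠ 0) {g : Γ} {c : k} (hRg : (R g)ᵀ * J * R g = c • J) :
    (S g).det = c := by
  have hinv := dotProduct_mulVec_of_transpose_mul hRg (e 0) (e 1)
  rw [hS g 0, hS g 1] at hinv
  simp only [Fin.sum_univ_two, Matrix.mulVec_add, Matrix.mulVec_smul, dotProduct_add, dotProduct_smul,
    add_dotProduct, smul_dotProduct, smul_eq_mul, dotProduct_mulVec_self_eq_zero hJ h2,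
    dotProduct_mulVec_swap hJ (e 0) (e 1)] at hinv
  rw [Matrix.det_fin_two]
  apply mul_right_cancel₀ hβ
  linear_combination hinv

end Matrices

end Summit.Langlands.Langlands.Theorems.PhantomRMTransport
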